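import Mathlib.Analysis.MeanInequalities
import Mathlib.MeasureTheory.Integral.Bochner.ContinuousLinearMap
import Literature.Analysis.FunctionSpaces.TorusScalarTrigPoly
import Literature.Analysis.FunctionSpaces.TorusSobolevNorm
import Literature.Analysis.FunctionSpaces.TorusCellAverages
import Literature.Analysis.FunctionSpaces.TorusGridCellsGeometry
import Literature.Analysis.FunctionSpaces.PoincareWirtingerConvex
import Literature.Analysis.FunctionSpaces.TorusPeriodization
import HarnessLib

/-!
# Vanishing cell averages force a small `Ḣ⁻¹` norm — proofs

Analysis/FunctionSpaces proofs file for the named fact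
`Torus.eHomSobolevSeminorm_neg_one_le_of_cellAverage_eq_zero` (`TorusCellAverages.lean`; the
estimate behind Bruè–De Lellis 2023, Thm. 4.1 (b), third line). This file proves the three
ingredients; the discharge itself is `TorusCellAveragesDischarge.lean`.

* `integral_mul_reTrigPoly_weight` — for `f ∈ L²(T^d; ℝ)`, a symmetric finite `S ⊆ ℤ^d` and an
  even real weight `w`, the real trigonometric polynomial `g = Re Σ_{k∈S} w(k) f̂(k) e_k` pairs
  with `f` to `∫ f g = Σ_{k∈S} w(k)|f̂(k)|²` (polarised Parseval, `hasSum_conj_mul_mFourierCoeff`,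
  a finite sum here); with `w(k) = |k|⁻²`, `∫ ‖∇g‖² = 4π² Σ_{k∈S} |k|⁻²|f̂(k)|²`
  (`integral_norm_sq_gradient_reTrigPoly_invWeight`);
* `enorm_setIntegral_gridCell_mul_le` — on one cell `Q` of mesh `N⁻¹`, if `∫_Q f∘proj = 0` then
  `|∫_Q (f∘proj)(g∘proj)| ≤ ‖f∘proj‖_{L²(Q)} (2ᵈ d N⁻² ∫_Q ‖D(g∘proj)‖²)^{1/2}` (subtract the
  cell average of `g∘proj`, Cauchy–Schwarz, Poincaré–Wirtinger on the convex cell of diameter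
  `√d/N`, `lintegral_enorm_sub_setAverage_sq_le`);
* `enorm_integral_mul_le_of_cellAverage` — summing over the `Nᵈ` cells of the fundamental cube
  and Cauchy–Schwarz for the sum: `|∫_{T^d} f g| ≤ (√(2ᵈ d)/N) ‖f‖_{L²} ‖∇g‖_{L²}`.

## References

* E. Bruè, C. De Lellis, Comm. Math. Phys. 400 (2023), Thm. 4.1 (b) with (4.3), §4.1 (ii).
* L. Grafakos, *Classical Fourier Analysis*, 3rd ed. (2014), Prop. 3.2.7 (3) (Parseval).
* L. C. Evans, *Partial Differential Equations*, 2nd ed. (2010), §5.8.1 (Poincaré).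
-/

noncomputable section

open MeasureTheory Set Filter UnitAddTorus
open scoped ENNReal NNReal ComplexConjugate

namespace Literature.Analysis.FunctionSpaces

namespace Torus

variable {d : Type*} [Fintype d] [DecidableEq d]

omit [DecidableEq d] in
/-- A non-zero frequency has positive squared length. [folklore] -/
theorem freqNormSq_pos_of_ne_zero {k : d → ℤ} (hk : k ≠ 0) : 0 < freqNormSq k := by
  obtain ⟨i, hi⟩ : ∃ i, k i ≠ 0 := by
    by_contra h
    push Not at h
    exact hk (funext h)
  have hi' : (0 : ℝ) < (k i : ℝ) ^ 2 := by
    have : (k i : ℝ) ≠ 0 := by exact_mod_cast hi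
    positivity
  exact lt_of_lt_of_le hi' (Finset.single_le_sum (f := fun j => (k j : ℝ) ^ 2)
    (fun j _ => sq_nonneg _) (Finset.mem_univ i))

omit [DecidableEq d] in
/-- **The weighted pairing identity.** For `f ∈ L²(T^d; ℝ)`, a symmetric finite frequency set
`S` and an even real weight `w`, the real trigonometric polynomial `g = Re Σ_{k∈S} w(k) f̂(k) e_k`
pairs with `f` to `∫ f g = Σ_{k∈S} w(k) |f̂(k)|²` (polarised Parseval, a finite sum here).
[folklore] -/
theorem integral_mul_reTrigPoly_weight {f : UnitAddTorus d → ℝ} (hf : MemLp f 2 volume)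
    {S : Finset (d → ℤ)} (hS : ∀ k ∈ S, -k ∈ S) {w : (d → ℤ) → ℝ} (hw : ∀ k, w (-k) = w k) :
    ∫ x, f x * reTrigPoly S (fun k => ((w k : ℝ) : ℂ) • mFourierCoeff (fun x => (f x : ℂ)) k) x =
      ∑ k ∈ S, w k * ‖mFourierCoeff (fun x => (f x : ℂ)) k‖ ^ 2 := by
  set Fc : UnitAddTorus d → ℂ := fun x => (f x : ℂ) with hFc
  set c : (d → ℤ) → ℂ := fun k => ((w k : ℝ) : ℂ) • mFourierCoeff Fc k with hcdef
  have hc : IsConjSymmScalar c := (isConjSymmScalar_mFourierCoeff f).real_smul hw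
  have hFm : MemLp Fc 2 volume := hf.ofReal
  have hgm : MemLp (fun x => ((reTrigPoly S c x : ℝ) : ℂ)) 2 volume := (memLp_reTrigPoly S c 2).ofReal
  have H := hasSum_conj_mul_mFourierCoeff hgm hFm
  have hcoef : ∀ k, mFourierCoeff (fun x => ((reTrigPoly S c x : ℝ) : ℂ)) k =
      if k ∈ S then c k else 0 := mFourierCoeff_ofReal_reTrigPoly hS hc
  simp_rw [hcoef] at H
  -- the sum is finite
  have H2 : HasSum (fun k => conj (if k ∈ S then c k else 0) * mFourierCoeff Fc k)
      (∑ k ∈ S, conj (if k ∈ S then c k else 0) * mFourierCoeff Fc k) :=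
    hasSum_sum_of_ne_finset_zero fun k hk => by simp [hk]
  have hsum : ∑ k ∈ S, conj (if k ∈ S then c k else 0) * mFourierCoeff Fc k =
      ∑ k ∈ S, conj (c k) * mFourierCoeff Fc k :=
    Finset.sum_congr rfl fun k hk => by simp [hk]
  have hint : ∫ x, conj (((reTrigPoly S c x : ℝ) : ℂ)) * Fc x =
      ((∫ x, f x * reTrigPoly S c x : ℝ) : ℂ) := by
    rw [← integral_complex_ofReal]
    refine integral_congr_ae (ae_of_all _ fun x => ?_)
    simp only [Complex.conj_ofReal, hFc, Complex.ofReal_mul]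
    ring
  have hterm : ∀ k, conj (c k) * mFourierCoeff Fc k = ((w k * ‖mFourierCoeff Fc k‖ ^ 2 : ℝ) : ℂ) := by
    intro k
    simp only [hcdef, smul_eq_mul, map_mul, Complex.conj_ofReal]
    rw [mul_assoc, Complex.conj_mul', Complex.ofReal_mul]
    push_cast
    ring
  have := H.unique H2
  rw [hint, hsum] at this
  simp_rw [hterm] at this
  rw [← Complex.ofReal_sum] at this
  exact_mod_cast this

/-- **Gradient norm of the weighted polynomial with weight `|k|⁻²`**: for
`g = Re Σ_{k∈S} |k|⁻² f̂(k) e_k` on a symmetric `S ∌ 0`,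
`∫ ‖∇g‖² = 4π² Σ_{k∈S} |k|⁻² |f̂(k)|²`. [folklore] -/
theorem integral_norm_sq_gradient_reTrigPoly_invWeight {f : UnitAddTorus d → ℝ}
    {S : Finset (d → ℤ)} (hS : ∀ k ∈ S, -k ∈ S) (hS0 : (0 : d → ℤ) ∉ S) :
    ∫ x, ‖Torus.gradient (reTrigPoly S (fun k => (((freqNormSq k)⁻¹ : ℝ) : ℂ) •
        mFourierCoeff (fun x => (f x : ℂ)) k)) x‖ ^ 2 =
      4 * Real.pi ^ 2 * ∑ k ∈ S, (freqNormSq k)⁻¹ * ‖mFourierCoeff (fun x => (f x : ℂ)) k‖ ^ 2 := by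
  have hw : ∀ k : d → ℤ, (freqNormSq (-k))⁻¹ = (freqNormSq k)⁻¹ := fun k => by rw [freqNormSq_neg]
  have hc : IsConjSymmScalar (fun k => (((freqNormSq k)⁻¹ : ℝ) : ℂ) •
      mFourierCoeff (fun x => (f x : ℂ)) k) := (isConjSymmScalar_mFourierCoeff f).real_smul hw
  rw [integral_norm_sq_gradient_reTrigPoly hS hc]
  congr 1
  refine Finset.sum_congr rfl fun k hk => ?_
  have hk0 : k ≠ 0 := fun h => hS0 (h ▸ hk)
  have hpos := freqNormSq_pos_of_ne_zero hk0
  rw [norm_smul, mul_pow, Complex.norm_real, Real.norm_eq_abs, abs_of_pos (inv_pos.2 hpos)]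
  field_simp

/-! ## The cellwise estimate -/

section Cellwise

open Module

omit [DecidableEq d] in
/-- On the torus, `‖D f (x)‖ = ‖∇f (x)‖` (the gradient is the Riesz representative of the
derivative). [folklore] -/
theorem norm_fderiv_eq_norm_gradient (θ : UnitAddTorus d → ℝ) (x : UnitAddTorus d) :
    ‖Torus.fderiv θ x‖ = ‖Torus.gradient θ x‖ := by
  rw [Torus.gradient, _root_.gradient, LinearIsometryEquiv.norm_map]
  rfl

omit [DecidableEq d] in
/-- Lower Lebesgue integrals over the torus are those of the lift over the fundamental cube
(for a.e.-measurable integrands). [folklore] -/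
theorem lintegral_eq_setLIntegral_unitCube_lift {φ : UnitAddTorus d → ℝ≥0∞}
    (hφ : AEMeasurable φ volume) : ∫⁻ x, φ x = ∫⁻ y in unitCube d, φ (proj y) := by
  have hmp := measurePreserving_proj_unitCube_holds (d := d)
  rw [← hmp.map_eq] at hφ ⊢
  rw [lintegral_map' hφ hmp.measurable.aemeasurable]

variable {N : ℕ} {f g : UnitAddTorus d → ℝ}

/-- **The cellwise estimate.** If `f ∈ L²(T^d)` has zero average on the cell `Q_N(j)` (read
on the lift) and `g` is smooth, then
`‖∫_{Q} (f∘proj)(g∘proj)‖ ≤ ‖f∘proj‖_{L²(Q)} · (2ᵈ d N⁻² ∫_Q ‖D(g∘proj)‖²)^{1/2}`: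
subtract the average of `g∘proj` over the cell (which pairs to zero with `f∘proj`), apply
Cauchy–Schwarz and the Poincaré–Wirtinger inequality on the (convex) cell of diameter
`≤ √d/N`. [folklore] -/
theorem enorm_setIntegral_gridCell_mul_le (hN : 0 < N) (hf : MemLp f 2 volume) (hg : IsSmooth g)
    (j : d → Fin N)
    (hcell : ∫ y in {y : EuclideanSpace ℝ d | (N : ℝ) • y - latticeVec (finIndex j) ∈ unitCube d},
      f (proj y) = 0) :
    ‖∫ y in {y : EuclideanSpace ℝ d | (N : ℝ) • y - latticeVec (finIndex j) ∈ unitCube d},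
        f (proj y) * g (proj y)‖ₑ ≤
      (∫⁻ y in {y : EuclideanSpace ℝ d | (N : ℝ) • y - latticeVec (finIndex j) ∈ unitCube d},
          ‖f (proj y)‖ₑ ^ 2) ^ (1 / 2 : ℝ) *
        (ENNReal.ofReal (2 ^ Fintype.card d * (Real.sqrt (Fintype.card d) / N) ^ 2) *
          ∫⁻ y in {y : EuclideanSpace ℝ d | (N : ℝ) • y - latticeVec (finIndex j) ∈ unitCube d},
            ‖_root_.fderiv ℝ (lift g) y‖ₑ ^ 2) ^ (1 / 2 : ℝ) := by
  set Q : Set (EuclideanSpace ℝ d) :=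
    {y | (N : ℝ) • y - latticeVec (finIndex j) ∈ unitCube d} with hQ
  have hQm : MeasurableSet Q := measurableSet_gridCell N _
  have hQsub : Q ⊆ unitCube d := gridCell_subset_unitCube hN j
  have hQvol : volume Q = ((N : ℝ≥0∞)⁻¹) ^ Fintype.card d := volume_gridCell hN _
  have hQ0 : volume Q ≠ 0 := by
    rw [hQvol]; exact pow_ne_zero _ (ENNReal.inv_ne_zero.2 (ENNReal.natCast_ne_top N))
  have hQt : volume Q ≠ ∞ := by
    rw [hQvol]; exact ENNReal.pow_ne_top (ENNReal.inv_ne_top.2 (by exact_mod_cast hN.ne'))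
  -- integrability on the cell
  have hmp := measurePreserving_proj_unitCube_holds (d := d)
  have hFi : IntegrableOn (fun y => f (proj y)) (unitCube d) volume :=
    (hmp.integrable_comp hf.aestronglyMeasurable).2 (hf.integrable one_le_two)
  have hgc : Continuous g := hg.continuous
  obtain ⟨C, hC⟩ := isCompact_univ.exists_bound_of_continuousOn hgc.continuousOn (f := g)
  have hGi : IntegrableOn (lift g) (unitCube d) volume :=
    (hmp.integrable_comp hgc.aestronglyMeasurable).2 hgc.integrable_unitAddTorus
  have hGm : AEStronglyMeasurable (fun y : EuclideanSpace ℝ d => g (proj y)) volume :=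
    (hgc.comp continuous_proj).aestronglyMeasurable
  have hFGi : IntegrableOn (fun y => f (proj y) * g (proj y)) Q volume :=
    (hFi.mono_set hQsub).mul_bdd hGm.restrict (ae_of_all _ fun y => hC _ (mem_univ _))
  -- subtract the cell average of `g ∘ proj`
  set a : ℝ := ⨍ y in Q, g (proj y) with ha
  have hsplit : ∫ y in Q, f (proj y) * g (proj y) = ∫ y in Q, f (proj y) * (g (proj y) - a) := by
    have h2 : IntegrableOn (fun y => f (proj y) * a) Q volume := (hFi.mono_set hQsub).mul_const a
    have e : ∀ y, f (proj y) * (g (proj y) - a) = f (proj y) * g (proj y) - f (proj y) * a :=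
      fun y => by ring
    simp_rw [e]
    rw [integral_sub hFGi h2, integral_mul_const, hcell, zero_mul, sub_zero]
  -- Cauchy–Schwarz
  have hFm : AEMeasurable (fun y => ‖f (proj y)‖ₑ) (volume.restrict Q) :=
    (hFi.mono_set hQsub).aestronglyMeasurable.enorm
  have hHm : AEMeasurable (fun y => ‖g (proj y) - a‖ₑ) (volume.restrict Q) :=
    (hGm.sub aestronglyMeasurable_const).restrict.enorm
  have hCS : ∫⁻ y in Q, ‖f (proj y)‖ₑ * ‖g (proj y) - a‖ₑ ≤
      (∫⁻ y in Q, ‖f (proj y)‖ₑ ^ 2) ^ (1 / 2 : ℝ) *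
        (∫⁻ y in Q, ‖g (proj y) - a‖ₑ ^ 2) ^ (1 / 2 : ℝ) := by
    have h := ENNReal.lintegral_mul_le_Lp_mul_Lq (volume.restrict Q)
      Real.HolderConjugate.two_two hFm hHm
    simp only [Pi.mul_apply, ENNReal.rpow_ofNat] at h
    simpa [one_div] using h
  -- Poincaré–Wirtinger on the cell
  have hPW : ∫⁻ y in Q, ‖g (proj y) - a‖ₑ ^ 2 ≤
      ENNReal.ofReal (2 ^ Fintype.card d * (Real.sqrt (Fintype.card d) / N) ^ 2) *
        ∫⁻ y in Q, ‖_root_.fderiv ℝ (lift g) y‖ₑ ^ 2 := by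
    have h := lintegral_enorm_sub_setAverage_sq_le (volume : Measure (EuclideanSpace ℝ d))
      (G := lift g) (hg.of_le (by exact_mod_cast le_top)) (convex_gridCell hN _) hQm hQ0 hQt
      (hGi.mono_set hQsub) (fun y hy z hz => norm_sub_le_of_mem_gridCell hN hy hz)
    rw [finrank_euclideanSpace] at h
    simpa only [lift_apply] using h
  calc ‖∫ y in Q, f (proj y) * g (proj y)‖ₑ
      = ‖∫ y in Q, f (proj y) * (g (proj y) - a)‖ₑ := by rw [hsplit]
    _ ≤ ∫⁻ y in Q, ‖f (proj y) * (g (proj y) - a)‖ₑ := enorm_integral_le_lintegral_enorm _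
    _ = ∫⁻ y in Q, ‖f (proj y)‖ₑ * ‖g (proj y) - a‖ₑ := by simp_rw [enorm_mul]
    _ ≤ _ := hCS
    _ ≤ _ := by gcongr

end Cellwise

/-! ## Summing over the cells -/

section Global

variable {N : ℕ} {f g : UnitAddTorus d → ℝ}

/-- `(x^{1/2})^2 = x` in `ℝ≥0∞` (real exponents). [folklore] -/
theorem _root_.ENNReal.rpow_inv_two_rpow_two (x : ℝ≥0∞) : (x ^ (2⁻¹ : ℝ)) ^ (2 : ℝ) = x := by
  rw [← ENNReal.rpow_mul]; norm_num

/-- **The global estimate.** If `f ∈ L²(T^d)` has zero average on every cell of mesh `N⁻¹`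
(read on the lift) and `g` is smooth, then
`|∫ f g| ≤ (√(2ᵈ d)/N) ‖f‖_{L²} ‖∇g‖_{L²}`: sum the cellwise estimates over the `Nᵈ` cells
of the fundamental cube and use the Cauchy–Schwarz inequality for the sum. [folklore] -/
theorem enorm_integral_mul_le_of_cellAverage (hN : 0 < N) (hf : MemLp f 2 volume)
    (hg : IsSmooth g)
    (hcell : ∀ m : d → ℤ,
      ∫ y in {y : EuclideanSpace ℝ d | (N : ℝ) • y - latticeVec m ∈ unitCube d}, f (proj y) = 0) :
    ‖∫ x, f x * g x‖ₑ ≤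
      ENNReal.ofReal (Real.sqrt (2 ^ Fintype.card d * Fintype.card d) / N) * eLpNorm f 2 volume *
        (∫⁻ x, ‖Torus.gradient g x‖ₑ ^ 2) ^ (1 / 2 : ℝ) := by
  set Q : (d → Fin N) → Set (EuclideanSpace ℝ d) :=
    fun j => {y | (N : ℝ) • y - latticeVec (finIndex j) ∈ unitCube d} with hQ
  set K : ℝ≥0∞ := ENNReal.ofReal (2 ^ Fintype.card d * (Real.sqrt (Fintype.card d) / N) ^ 2) with hK
  set A : (d → Fin N) → ℝ≥0∞ := fun j => ∫⁻ y in Q j, ‖f (proj y)‖ₑ ^ 2 with hA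
  set E : (d → Fin N) → ℝ≥0∞ := fun j => ∫⁻ y in Q j, ‖_root_.fderiv ℝ (lift g) y‖ₑ ^ 2 with hE
  have hmp := measurePreserving_proj_unitCube_holds (d := d)
  have hgc : Continuous g := hg.continuous
  obtain ⟨C, hC⟩ := isCompact_univ.exists_bound_of_continuousOn hgc.continuousOn (f := g)
  have hFi : IntegrableOn (fun y => f (proj y)) (unitCube d) volume :=
    (hmp.integrable_comp hf.aestronglyMeasurable).2 (hf.integrable one_le_two)
  have hGm : AEStronglyMeasurable (fun y : EuclideanSpace ℝ d => g (proj y)) volume :=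
    (hgc.comp continuous_proj).aestronglyMeasurable
  have hFGi : IntegrableOn (fun y => f (proj y) * g (proj y)) (unitCube d) volume :=
    hFi.mul_bdd hGm.restrict (ae_of_all _ fun y => hC _ (mem_univ _))
  -- Step 1: to the fundamental cube, and into cells
  have h1 : ∫ x, f x * g x = ∑ j : d → Fin N, ∫ y in Q j, f (proj y) * g (proj y) := by
    rw [integral_eq_integral_lift_holds (fun x => f x * g x)]
    exact integral_unitCube_eq_sum_gridCell hN hFGi
  -- Step 2: cellwise estimates
  have h2 : ‖∫ x, f x * g x‖ₑ ≤ ∑ j : d → Fin N, (A j) ^ (1 / 2 : ℝ) * (K * E j) ^ (1 / 2 : ℝ) := by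
    rw [h1]
    refine (enorm_sum_le _ _).trans (Finset.sum_le_sum fun j _ => ?_)
    exact enorm_setIntegral_gridCell_mul_le hN hf hg j (hcell (finIndex j))
  -- Step 3: Cauchy–Schwarz for the sum
  have h3 : ∑ j : d → Fin N, (A j) ^ (1 / 2 : ℝ) * (K * E j) ^ (1 / 2 : ℝ) ≤
      K ^ (1 / 2 : ℝ) * ((∑ j, A j) ^ (1 / 2 : ℝ) * (∑ j, E j) ^ (1 / 2 : ℝ)) := by
    have hcs := ENNReal.inner_le_Lp_mul_Lq Finset.univ (fun j => (A j) ^ (1 / 2 : ℝ))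
      (fun j => (E j) ^ (1 / 2 : ℝ)) Real.HolderConjugate.two_two
    simp only [one_div] at hcs
    simp only [ENNReal.rpow_inv_two_rpow_two] at hcs
    calc ∑ j : d → Fin N, (A j) ^ (1 / 2 : ℝ) * (K * E j) ^ (1 / 2 : ℝ)
        = K ^ (1 / 2 : ℝ) * ∑ j : d → Fin N, (A j) ^ (1 / 2 : ℝ) * (E j) ^ (1 / 2 : ℝ) := by
          rw [Finset.mul_sum]
          refine Finset.sum_congr rfl fun j _ => ?_
          rw [ENNReal.mul_rpow_of_nonneg _ _ (by norm_num : (0 : ℝ) ≤ 1 / 2)]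
          ring
      _ ≤ _ := by
          gcongr
          simpa [one_div] using hcs
  -- Step 4: the two sums are global `L²` quantities
  have h4 : ∑ j, A j = eLpNorm f 2 volume ^ (2 : ℝ) := by
    rw [hA, ← lintegral_unitCube_eq_sum_gridCell hN (fun y => ‖f (proj y)‖ₑ ^ 2),
      ← lintegral_eq_setLIntegral_unitCube_lift (φ := fun x => ‖f x‖ₑ ^ 2)
        (hf.aestronglyMeasurable.enorm.pow_const _),
      eLpNorm_eq_lintegral_rpow_enorm_toReal two_ne_zero ENNReal.ofNat_ne_top,
      ENNReal.toReal_ofNat, one_div, ENNReal.rpow_inv_two_rpow_two]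
    refine lintegral_congr fun x => ?_
    rw [ENNReal.rpow_ofNat]
  have h5 : ∑ j, E j = ∫⁻ x, ‖Torus.gradient g x‖ₑ ^ 2 := by
    rw [hE]
    rw [← lintegral_unitCube_eq_sum_gridCell hN (fun y => ‖_root_.fderiv ℝ (lift g) y‖ₑ ^ 2),
      lintegral_eq_setLIntegral_unitCube_lift (φ := fun x => ‖Torus.gradient g x‖ₑ ^ 2)
        (hg.gradient.continuous.measurable.enorm.pow_const _).aemeasurable]
    refine setLIntegral_congr_fun measurableSet_unitCube fun y _ => ?_
    rw [fderiv_lift, ← ofReal_norm, ← ofReal_norm, norm_fderiv_eq_norm_gradient]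
  have hK2 : K ^ (1 / 2 : ℝ) = ENNReal.ofReal (Real.sqrt (2 ^ Fintype.card d * Fintype.card d) / N) := by
    rw [hK, ENNReal.ofReal_rpow_of_nonneg (by positivity) (by norm_num), ← Real.sqrt_eq_rpow]
    congr 1
    rw [div_pow, Real.sq_sqrt (Nat.cast_nonneg _), ← mul_div_assoc, Real.sqrt_div' _ (by positivity),
      Real.sqrt_sq (Nat.cast_nonneg _)]
  calc ‖∫ x, f x * g x‖ₑ ≤ _ := h2
    _ ≤ _ := h3
    _ = _ := by
        rw [h4, h5, hK2, ← ENNReal.rpow_mul]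
        norm_num
        ring

end Global

end Torus

end Literature.Analysis.FunctionSpaces

end
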